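import Mathlib
import Summits.NavierStokesRegularity.NavierStokesRegularity.Theses.FilamentSkeletonRss

/-!
# Route FilamentSkeletonRss · crux `CoreGluing` (stmt-NavierStokesRegularity-15401) — line `Sketch`, tool stub `stub_ellipticDatumSlipModel`

Helper file (theorems only) supporting the crux item; lands with `--supports stmt-NavierStokesRegularity-15401`.

**Link (slip) for the elliptic `C₄` datum `D*`.** In the `Γ → ∞` inner model a `C₄` configuration is
four straight lines `P_k + s e_k`, the images of line `0` (`P₀ = (−2, −3/2, −2)`, `e₀ = (6,3,2)/7`)
under the quarter turn `R(x,y,z) = (−y,x,z)`; the rescaled skeleton field is the Leray drift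
`½x − e₃ × x` (`α = 1`) plus the straight-line Biot–Savart induction
`Σ_{k≠0} e_k × (x − P_k)/|(x − P_k)_⊥|²` (`γ/2π = 1`), `|r_⊥|² = ‖r‖² − ⟪r, e_k⟫²`.
This file proves that the tangential component of that field along line `0`, `x = P₀ + t e₀`, is the
closed-form rational slip
`W(t) = t/2 − 53/28 + 2352/(9540t² − 56532t + 84329) + 1176/(720t² − 3696t + 6664) + 2352/(9540t² − 41412t + 45521)`.

Proof: pure coordinate algebra. With `x = (−2 + 6t/7, −3/2 + 3t/7, −2 + 2t/7)`,
`‖x − P₁‖² − ⟪x − P₁, e₁⟫² = (9540t² − 56532t + 84329)/9604`,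
`‖x − P₂‖² − ⟪x − P₂, e₂⟫² = (720t² − 3696t + 6664)/2401`,
`‖x − P₃‖² − ⟪x − P₃, e₃'⟫² = (9540t² − 41412t + 45521)/9604`, the slip numerators
`⟪e_k × (x − P_k), e₀⟫ = 12/49, 24/49, 12/49`, and the drift slips by `t/2 − 53/28`; the three
denominators are positive for every `t` (negative discriminants), and the rest is `field_simp; ring`.
The coordinate helper lemmas are adapted from the sibling tools file
`Theorems/FilamentSkeletonRssSkeletonEquilibriumLineSlipModel.lean`.
-/

set_option linter.dupNamespace false

noncomputable section

namespace Summit.NavierStokesRegularity.NavierStokesRegularity.Theorems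

open Literature.Analysis.FluidPDE
open scoped RealInnerProductSpace

/-- Coordinates of the inner product on `ℝ³`. [folklore] -/
private theorem slip_inner_three (a b : EuclideanSpace ℝ (Fin 3)) :
    inner ℝ a b = a 0 * b 0 + a 1 * b 1 + a 2 * b 2 := by
  simp [PiLp.inner_apply, Fin.sum_univ_three, mul_comm]

/-- `‖a‖² = Σ aᵢ²` on `ℝ³`. [folklore] -/
private theorem slip_norm_sq_three (a : EuclideanSpace ℝ (Fin 3)) :
    ‖a‖ ^ 2 = a 0 ^ 2 + a 1 ^ 2 + a 2 ^ 2 := by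
  rw [EuclideanSpace.real_norm_sq_eq, Fin.sum_univ_three]

/-- Coordinates of the triple product `⟨a × b, c⟩` on `ℝ³`. [folklore] -/
private theorem slip_inner_cross_three (a b c : EuclideanSpace ℝ (Fin 3)) :
    inner ℝ (cross a b) c = (a 1 * b 2 - a 2 * b 1) * c 0 + (a 2 * b 0 - a 0 * b 2) * c 1
      + (a 0 * b 1 - a 1 * b 0) * c 2 := by
  rw [slip_inner_three]
  simp [cross, cross_apply]

/-- Line `1` seen from line `0` of the datum `D*`: `|(x − P₁)_⊥|² = (9540t² − 56532t + 84329)/9604`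
and `⟪e₁ × (x − P₁), e₀⟫ = 12/49` at `x = P₀ + t e₀`. [folklore] -/
private theorem slip_data_one (t : ℝ) :
    ‖(!₂[((-2) : ℝ), (-(3 / 2 : ℝ)), ((-2) : ℝ)] + t • !₂[(6 / 7 : ℝ), (3 / 7 : ℝ), (2 / 7 : ℝ)])
        - !₂[(3 / 2 : ℝ), ((-2) : ℝ), ((-2) : ℝ)]‖ ^ 2
      - (inner ℝ ((!₂[((-2) : ℝ), (-(3 / 2 : ℝ)), ((-2) : ℝ)] + t • !₂[(6 / 7 : ℝ), (3 / 7 : ℝ), (2 / 7 : ℝ)])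
        - !₂[(3 / 2 : ℝ), ((-2) : ℝ), ((-2) : ℝ)]) !₂[(-(3 / 7 : ℝ)), (6 / 7 : ℝ), (2 / 7 : ℝ)]) ^ 2
        = (9540 * t ^ 2 - 56532 * t + 84329) / 9604 ∧
      inner ℝ (cross !₂[(-(3 / 7 : ℝ)), (6 / 7 : ℝ), (2 / 7 : ℝ)]
        ((!₂[((-2) : ℝ), (-(3 / 2 : ℝ)), ((-2) : ℝ)] + t • !₂[(6 / 7 : ℝ), (3 / 7 : ℝ), (2 / 7 : ℝ)])
          - !₂[(3 / 2 : ℝ), ((-2) : ℝ), ((-2) : ℝ)]))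
        !₂[(6 / 7 : ℝ), (3 / 7 : ℝ), (2 / 7 : ℝ)] = 12 / 49 := by
  rw [slip_norm_sq_three, slip_inner_three, slip_inner_cross_three]
  simp
  constructor <;> ring

/-- Line `2` seen from line `0` of the datum `D*`: `|(x − P₂)_⊥|² = (720t² − 3696t + 6664)/2401`
and `⟪e₂ × (x − P₂), e₀⟫ = 24/49` at `x = P₀ + t e₀`. [folklore] -/
private theorem slip_data_two (t : ℝ) :
    ‖(!₂[((-2) : ℝ), (-(3 / 2 : ℝ)), ((-2) : ℝ)] + t • !₂[(6 / 7 : ℝ), (3 / 7 : ℝ), (2 / 7 : ℝ)])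
        - !₂[(2 : ℝ), (3 / 2 : ℝ), ((-2) : ℝ)]‖ ^ 2
      - (inner ℝ ((!₂[((-2) : ℝ), (-(3 / 2 : ℝ)), ((-2) : ℝ)] + t • !₂[(6 / 7 : ℝ), (3 / 7 : ℝ), (2 / 7 : ℝ)])
        - !₂[(2 : ℝ), (3 / 2 : ℝ), ((-2) : ℝ)]) !₂[(-(6 / 7 : ℝ)), (-(3 / 7 : ℝ)), (2 / 7 : ℝ)]) ^ 2
        = (720 * t ^ 2 - 3696 * t + 6664) / 2401 ∧
      inner ℝ (cross !₂[(-(6 / 7 : ℝ)), (-(3 / 7 : ℝ)), (2 / 7 : ℝ)]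
        ((!₂[((-2) : ℝ), (-(3 / 2 : ℝ)), ((-2) : ℝ)] + t • !₂[(6 / 7 : ℝ), (3 / 7 : ℝ), (2 / 7 : ℝ)])
          - !₂[(2 : ℝ), (3 / 2 : ℝ), ((-2) : ℝ)]))
        !₂[(6 / 7 : ℝ), (3 / 7 : ℝ), (2 / 7 : ℝ)] = 24 / 49 := by
  rw [slip_norm_sq_three, slip_inner_three, slip_inner_cross_three]
  simp
  constructor <;> ring

/-- Line `3` seen from line `0` of the datum `D*`: `|(x − P₃)_⊥|² = (9540t² − 41412t + 45521)/9604`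
and `⟪e₃' × (x − P₃), e₀⟫ = 12/49` at `x = P₀ + t e₀`. [folklore] -/
private theorem slip_data_three (t : ℝ) :
    ‖(!₂[((-2) : ℝ), (-(3 / 2 : ℝ)), ((-2) : ℝ)] + t • !₂[(6 / 7 : ℝ), (3 / 7 : ℝ), (2 / 7 : ℝ)])
        - !₂[(-(3 / 2 : ℝ)), (2 : ℝ), ((-2) : ℝ)]‖ ^ 2
      - (inner ℝ ((!₂[((-2) : ℝ), (-(3 / 2 : ℝ)), ((-2) : ℝ)] + t • !₂[(6 / 7 : ℝ), (3 / 7 : ℝ), (2 / 7 : ℝ)])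
        - !₂[(-(3 / 2 : ℝ)), (2 : ℝ), ((-2) : ℝ)]) !₂[(3 / 7 : ℝ), (-(6 / 7 : ℝ)), (2 / 7 : ℝ)]) ^ 2
        = (9540 * t ^ 2 - 41412 * t + 45521) / 9604 ∧
      inner ℝ (cross !₂[(3 / 7 : ℝ), (-(6 / 7 : ℝ)), (2 / 7 : ℝ)]
        ((!₂[((-2) : ℝ), (-(3 / 2 : ℝ)), ((-2) : ℝ)] + t • !₂[(6 / 7 : ℝ), (3 / 7 : ℝ), (2 / 7 : ℝ)])
          - !₂[(-(3 / 2 : ℝ)), (2 : ℝ), ((-2) : ℝ)]))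
        !₂[(6 / 7 : ℝ), (3 / 7 : ℝ), (2 / 7 : ℝ)] = 12 / 49 := by
  rw [slip_norm_sq_three, slip_inner_three, slip_inner_cross_three]
  simp
  constructor <;> ring

/-- The drift `½x − e₃ × x` at `x = P₀ + t e₀` slips by `t/2 − 53/28` along `e₀`
(`⟪P₀, e₀⟫ = −41/14`, `⟪e₃ × P₀, e₀⟫ = 3/7`, `⟪e₃ × e₀, e₀⟫ = 0`). [folklore] -/
private theorem slip_drift (t : ℝ) :
    inner ℝ ((1 / 2 : ℝ) • (!₂[((-2) : ℝ), (-(3 / 2 : ℝ)), ((-2) : ℝ)] + t • !₂[(6 / 7 : ℝ), (3 / 7 : ℝ), (2 / 7 : ℝ)])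
      - (1 : ℝ) • cross (EuclideanSpace.single (2 : Fin 3) (1 : ℝ))
        (!₂[((-2) : ℝ), (-(3 / 2 : ℝ)), ((-2) : ℝ)] + t • !₂[(6 / 7 : ℝ), (3 / 7 : ℝ), (2 / 7 : ℝ)]))
      !₂[(6 / 7 : ℝ), (3 / 7 : ℝ), (2 / 7 : ℝ)] = t / 2 - 53 / 28 := by
  rw [inner_sub_left, real_inner_smul_left, real_inner_smul_left, slip_inner_three,
    slip_inner_cross_three]
  simp
  ring

/-- **Link (slip).** Along the line `P₀ + t e₀` of the elliptic C₄ datum `D*` (`P₀ = (−2, −3/2, −2)`,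
`e₀ = (6,3,2)/7`, images `P_k = R^k P₀`, `e_k = R^k e₀` under the quarter turn `R` about `e₃`, `γ/2π = 1`, `α = 1`),
the tangential component of the inner (`Γ → ∞`, rescaled) skeleton field — Leray drift `½x − e₃ × x` plus the straight-line
Biot–Savart induction `Σ_k e_k × (x − P_k)/|(x − P_k)_⊥|²` of the three image lines — is the closed-form rational slip `W`.
[folklore] -/
theorem stub_ellipticDatumSlipModel :
    ∀ (x : EuclideanSpace ℝ (Fin 3)) (t : ℝ), x = !₂[((-2) : ℝ), (-(3 / 2 : ℝ)), ((-2) : ℝ)] + t • !₂[(6 / 7 : ℝ), (3 / 7 : ℝ), (2 / 7 : ℝ)] →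
      inner ℝ ((1 / 2 : ℝ) • x - (1 : ℝ) • Literature.Analysis.FluidPDE.cross (EuclideanSpace.single (2 : Fin 3) (1 : ℝ)) x + ((1 : ℝ) / (‖x - !₂[(3 / 2 : ℝ), ((-2) : ℝ), ((-2) : ℝ)]‖ ^ 2 - (inner ℝ (x - !₂[(3 / 2 : ℝ), ((-2) : ℝ), ((-2) : ℝ)]) !₂[(-(3 / 7 : ℝ)), (6 / 7 : ℝ), (2 / 7 : ℝ)]) ^ 2)) • Literature.Analysis.FluidPDE.cross !₂[(-(3 / 7 : ℝ)), (6 / 7 : ℝ), (2 / 7 : ℝ)] (x - !₂[(3 / 2 : ℝ), ((-2) : ℝ), ((-2) : ℝ)]) + ((1 : ℝ) / (‖x - !₂[(2 : ℝ), (3 / 2 : ℝ), ((-2) : ℝ)]‖ ^ 2 - (inner ℝ (x - !₂[(2 : ℝ), (3 / 2 : ℝ), ((-2) : ℝ)]) !₂[(-(6 / 7 : ℝ)), (-(3 / 7 : ℝ)), (2 / 7 : ℝ)]) ^ 2)) • Literature.Analysis.FluidPDE.cross !₂[(-(6 / 7 : ℝ)), (-(3 / 7 : ℝ)), (2 / 7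 : ℝ)] (x - !₂[(2 : ℝ), (3 / 2 : ℝ), ((-2) : ℝ)]) + ((1 : ℝ) / (‖x - !₂[(-(3 / 2 : ℝ)), (2 : ℝ), ((-2) : ℝ)]‖ ^ 2 - (inner ℝ (x - !₂[(-(3 / 2 : ℝ)), (2 : ℝ), ((-2) : ℝ)]) !₂[(3 / 7 : ℝ), (-(6 / 7 : ℝ)), (2 / 7 : ℝ)]) ^ 2)) • Literature.Analysis.FluidPDE.cross !₂[(3 / 7 : ℝ), (-(6 / 7 : ℝ)), (2 / 7 : ℝ)] (x - !₂[(-(3 / 2 : ℝ)), (2 : ℝ), ((-2) : ℝ)])) !₂[(6 / 7 : ℝ), (3 / 7 : ℝ), (2 / 7 : ℝ)] =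
        t / 2 + (-(53 / 28 : ℝ)) + (2352 : ℝ) / (9540 * t ^ 2 - 56532 * t + 84329) + (1176 : ℝ) / (720 * t ^ 2 - 3696 * t + 6664) + (2352 : ℝ) / (9540 * t ^ 2 - 41412 * t + 45521) := by
  intro x t hx
  subst hx
  obtain ⟨hq1, hm1⟩ := slip_data_one t
  obtain ⟨hq2, hm2⟩ := slip_data_two t
  obtain ⟨hq3, hm3⟩ := slip_data_three t
  rw [inner_add_left, inner_add_left, inner_add_left, real_inner_smul_left, real_inner_smul_left,
    real_inner_smul_left, hq1, hm1, hq2, hm2, hq3, hm3, slip_drift t]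
  have hp1 : 0 < 9540 * t ^ 2 - 56532 * t + 84329 := by nlinarith [sq_nonneg (9540 * t - 28266)]
  have hp2 : 0 < 720 * t ^ 2 - 3696 * t + 6664 := by nlinarith [sq_nonneg (720 * t - 1848)]
  have hp3 : 0 < 9540 * t ^ 2 - 41412 * t + 45521 := by nlinarith [sq_nonneg (9540 * t - 20706)]
  field_simp
  ring

end Summit.NavierStokesRegularity.NavierStokesRegularity.Theorems
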